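import Summits.Ventures.CertifiedArithmetic.LowPrec.SRPythagorasOneBit
import Summits.Ventures.CertifiedArithmetic.LowPrec.SRPythagorasAllSigns
import HarnessLib

/-!
# Stochastic rounding with limited randomness, CIV: ONE random bit obeys the Pythagorean law on every
window and on the whole range of every format; the adaptive two-bit counterexample

HONEST FRAMING: certified error envelopes and provably optimal rounding/accumulation schemes for
low-precision formats under stated cost models; every table by two implementations; no hardware or
vendor claims.

Venture CertifiedArithmetic / lowprec, SR slice; instances of CIII (`SRPythagorasOneBit`: the law
`E(ŝₙ − sₙ)² ≤ n·G²/4 + (n·ε·G)²` for every rule with mean absolute error `≤ ε·gap`, adaptive summands,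
every window) for the IEEE P3109 limited-randomness modes.

* `probAwayA_sameSide` (`N ≥ 1`), `probAwayB_sameSide`, `probAwayC_sameSide` (every `N`) —
  StochasticA/B/C are SIGN-CONSISTENT: they round up with probability `≥ 1/2` exactly when the residual
  is `≥ 1/2` (integrality of `⌊2^N η⌋`, `⌊2^N η + 1/2⌋`, `RNITE(2^N η)` and parity of `2^N`).
* `stochasticA_one_acc_sq_le` — **IEEE P3109 StochasticA with ONE random bit obeys its NOMINAL
  Pythagorean law `E(ŝₙ − sₙ)² ≤ n·G²/4 + (n·2^{-1}·G)²` on every unsaturated tree of every finite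
  value set** — any window, any signs, and (`stochasticA_one_accErr_sq_le`) adaptive summands; compare
  XCIII (`N + 1` bits across ONE binade boundary), XCIV (`N ≥ J` bits on `J + 1` binades) and CI (drift-
  antitone on the whole range iff `N ≥ emaxCode − 1`; `Formats.e3m2_threeBinade_A1_not`: one bit is not
  antitone on three binades — `e3m2_threeBinade_A1_certified` below certifies that very tree).
* `valueSet_stochasticA_one` — **the whole range `[−maxRat, maxRat]` of every binary format `φ`, one
  bit, `NoSat` the only hypothesis**, `G = 2^{emaxCode−1}·quantum` the top spacing
  (`valueSet_gapLE_of_noSat`): literally the conclusion of XCVIII `valueSet_stochasticA_all` at `N = 1`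
  without its threshold `emaxCode − 1 ≤ N`.
* `stochasticA_acc_sq_le_half`, `stochasticB_acc_sq_le_half`, `stochasticC_acc_sq_le_half` — the
  `ε = 1/2` law for StochasticA (`N ≥ 1`), StochasticB and StochasticC (every `N`) on every window.  For
  StochasticB with one bit the NOMINAL law (`ε = 1/4`) is FALSE across a binade boundary (XCII
  `Formats.e3m2_pyth_fails_stochasticB1`, `129/16 > 8`); the `ε = 1/2` law certifies the same data
  (`Formats.e3m2_W2_stochasticB1_halfLaw`, `129/16 ≤ 20`).
* `Formats.e3m2_oneBit_nearTight` — the one-bit law is nearly attained: E3M2 `[8,16]`, `ŝ₀ = 8`, three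
  summands `63/32`: `E(ŝ₃ − s₃)² = 11721/1024` against the bound `12`.
* `Formats.e3m2_adaptive_twoBits_violates` — **with TWO random bits an adaptive adversary breaks the
  nominal law inside ONE binade**: E3M2 `[8,16]` (gap `2`), `ŝ₀ = 8`, first summand `47/32`, second
  summand `1` after rounding up and `47/32` after rounding down: `E(ŝ₂ − exact)² = 6181/2048 > 3 =
  2·G²/4 + (2·2^{-2}·G)²`, while both FROZEN summand sequences obey the law (`2273/1024`, `737/256 ≤ 3`)
  and one bit obeys its law on the same adaptive data (`6181/2048 ≤ 6`).  The two subtrees after the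
  first rounding are honest fixed-summand trees, so NO induction on the number of additions whose
  hypothesis on the subtrees is a function of (initial error, remaining steps) alone — no potential of
  CIII's kind, nor XCII's bookkeeping without the antitone sign — proves the two-bit law: a proof for
  `2 ≤ N ≤ emaxCode − 2` bits (if the law holds: no violation with fixed summands is known, sr-seat
  certificates gen16–gen18, evidence only) must couple the sibling subtrees, which share their summands.

NOT claimed: the law for StochasticA with `2 ≤ N ≤ emaxCode − 2` bits and fixed summands (OPEN).
Prior art as in CIII; [FitzgibbonFelix2025] analyse the BIAS of few-bit SR modes (SRFF/SRF/SRC), not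
accumulated mean square error.  No Mathlib precedent.
-/

namespace Summit.Ventures.CertifiedArithmetic.LowPrec.SR

open Literature.ComputerArithmetic.ConnollyHighamMary2021
open Finset

variable {K : Type*} [Field K] [LinearOrder K] [IsStrictOrderedRing K]

namespace LimitedBits

section P3109

open Literature.ComputerArithmetic.P3109 (rnite)

variable [FloorRing K]

/-- **StochasticA with `N ≥ 1` random bits is sign-consistent**: `⌊2^N η⌋/2^N ≥ 1/2` iff `η ≥ 1/2`. -/
theorem probAwayA_sameSide {N : ℕ} (hN : 1 ≤ N) (η : K) :
    0 ≤ (probAwayA N η - 1 / 2) * (η - 1 / 2) := by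
  obtain ⟨M, rfl⟩ : ∃ M, N = M + 1 := ⟨N - 1, by omega⟩
  have h2M : (0 : K) < 2 ^ M := by positivity
  have h2 : (0 : K) < 2 ^ (M + 1) := by positivity
  rcases le_or_gt (1 / 2 : K) η with h | h
  · refine mul_nonneg ?_ (by linarith)
    have h2eq : (2 : K) ^ (M + 1) = 2 ^ M * 2 := pow_succ 2 M
    have hfl : (2 : ℤ) ^ M ≤ ⌊η * 2 ^ (M + 1)⌋ := by
      rw [Int.le_floor]; push_cast; rw [h2eq]
      nlinarith [mul_nonneg h2M.le (by linarith : (0 : K) ≤ 2 * η - 1)]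
    have hK : ((2 : ℤ) ^ M : K) ≤ (⌊η * 2 ^ (M + 1)⌋ : K) := by exact_mod_cast hfl
    push_cast at hK
    unfold probAwayA
    rw [sub_nonneg, le_div_iff₀ h2]
    linarith
  · have := probAwayA_le (M + 1) η
    exact mul_nonneg_of_nonpos_of_nonpos (by linarith) (by linarith)

/-- **StochasticB is sign-consistent for every `N`** (for `N = 0` it is round-to-nearest). -/
theorem probAwayB_sameSide (N : ℕ) (η : K) :
    0 ≤ (probAwayB N η - 1 / 2) * (η - 1 / 2) := by
  have h2 : (0 : K) < 2 ^ N := by positivity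
  unfold probAwayB
  rcases le_or_gt (1 / 2 : K) η with h | h
  · refine mul_nonneg ?_ (by linarith)
    have hη : 1 / 2 * 2 ^ N ≤ η * 2 ^ N := mul_le_mul_of_nonneg_right h h2.le
    have hlt := Int.lt_floor_add_one (η * 2 ^ N + 1 / 2)
    have hint : (2 : ℤ) ^ N - 1 < 2 * ⌊η * 2 ^ N + 1 / 2⌋ := by
      have : ((2 : ℤ) ^ N : K) - 1 < 2 * (⌊η * 2 ^ N + 1 / 2⌋ : K) := by push_cast; linarith
      exact_mod_cast this
    have hint' : (2 : ℤ) ^ N ≤ 2 * ⌊η * 2 ^ N + 1 / 2⌋ := by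
      have := Int.lt_iff_add_one_le.mp hint; linarith
    have hK : ((2 : ℤ) ^ N : K) ≤ 2 * (⌊η * 2 ^ N + 1 / 2⌋ : K) := by exact_mod_cast hint'
    push_cast at hK
    rw [sub_nonneg, le_div_iff₀ h2]
    linarith
  · have hη : η * 2 ^ N < 1 / 2 * 2 ^ N := mul_lt_mul_of_pos_right h h2
    have hle := Int.floor_le (η * 2 ^ N + 1 / 2)
    have hint : 2 * ⌊η * 2 ^ N + 1 / 2⌋ < (2 : ℤ) ^ N + 1 := by
      have : 2 * (⌊η * 2 ^ N + 1 / 2⌋ : K) < ((2 : ℤ) ^ N : K) + 1 := by push_cast; linarith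
      exact_mod_cast this
    have hint' : 2 * ⌊η * 2 ^ N + 1 / 2⌋ ≤ (2 : ℤ) ^ N := Int.lt_add_one_iff.mp hint
    have hK : 2 * (⌊η * 2 ^ N + 1 / 2⌋ : K) ≤ ((2 : ℤ) ^ N : K) := by exact_mod_cast hint'
    push_cast at hK
    have hq : (⌊η * 2 ^ N + 1 / 2⌋ : K) / 2 ^ N ≤ 1 / 2 := by rw [div_le_iff₀ h2]; linarith
    exact mul_nonneg_of_nonpos_of_nonpos (by linarith) (by linarith)

/-- **StochasticC is sign-consistent for every `N`** (`|RNITE(X) − X| ≤ 1/2` and integrality; for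
`N = 0` it is round-to-nearest-even). -/
theorem probAwayC_sameSide (N : ℕ) (η : K) :
    0 ≤ (probAwayC N η - 1 / 2) * (η - 1 / 2) := by
  have h2 : (0 : K) < 2 ^ N := by positivity
  obtain ⟨hlo, hhi⟩ := abs_le.mp (abs_rnite_sub_le (η * 2 ^ N))
  unfold probAwayC
  rcases lt_trichotomy η (1 / 2) with h | h | h
  · have hη : η * 2 ^ N < 1 / 2 * 2 ^ N := mul_lt_mul_of_pos_right h h2
    have hint : 2 * rnite (η * 2 ^ N) < (2 : ℤ) ^ N + 1 := by
      have : 2 * (rnite (η * 2 ^ N) : K) < ((2 : ℤ) ^ N : K) + 1 := by push_cast; linarith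
      exact_mod_cast this
    have hint' : 2 * rnite (η * 2 ^ N) ≤ (2 : ℤ) ^ N := Int.lt_add_one_iff.mp hint
    have hK : 2 * (rnite (η * 2 ^ N) : K) ≤ ((2 : ℤ) ^ N : K) := by exact_mod_cast hint'
    push_cast at hK
    have hq : (rnite (η * 2 ^ N) : K) / 2 ^ N ≤ 1 / 2 := by rw [div_le_iff₀ h2]; linarith
    exact mul_nonneg_of_nonpos_of_nonpos (by linarith) (by linarith)
  · rw [h]; simp
  · refine mul_nonneg ?_ (by linarith)
    have hη : 1 / 2 * 2 ^ N < η * 2 ^ N := mul_lt_mul_of_pos_right h h2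
    have hint : (2 : ℤ) ^ N - 1 < 2 * rnite (η * 2 ^ N) := by
      have : ((2 : ℤ) ^ N : K) - 1 < 2 * (rnite (η * 2 ^ N) : K) := by push_cast; linarith
      exact_mod_cast this
    have hint' : (2 : ℤ) ^ N ≤ 2 * rnite (η * 2 ^ N) := by
      have := Int.lt_iff_add_one_le.mp hint; linarith
    have hK : ((2 : ℤ) ^ N : K) ≤ 2 * (rnite (η * 2 ^ N) : K) := by exact_mod_cast hint'
    push_cast at hK
    rw [sub_nonneg, le_div_iff₀ h2]
    linarith

/-- **StochasticA, `N ≥ 1` bits, every window**: `E(ŝₙ − sₙ)² ≤ n·G²/4 + (n·G/2)²` (no saturating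
branch, gaps `≤ G`; any finite value set, any sign pattern). -/
theorem stochasticA_acc_sq_le_half (F : Finset K) {N : ℕ} (hN : 1 ≤ N) {G : K} :
    ∀ (x : ℕ → K) (n : ℕ) (s : K), NoSat F x n s → GapLE F G x n s →
      accExpQ F (probAwayA N) x n (fun t => (t - (s + ∑ i ∈ range n, x i)) ^ 2) s
        ≤ n * (G ^ 2 / 4) + (n * (1 / 2 * G)) ^ 2 :=
  accExpQ_sq_le_of_sameSide F (probAwayA_mem N) (fun η _ _ => probAwayA_sameSide hN η)

/-- **StochasticB, every `N`, every window**: `E(ŝₙ − sₙ)² ≤ n·G²/4 + (n·G/2)²`. -/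
theorem stochasticB_acc_sq_le_half (F : Finset K) (N : ℕ) {G : K} :
    ∀ (x : ℕ → K) (n : ℕ) (s : K), NoSat F x n s → GapLE F G x n s →
      accExpQ F (probAwayB N) x n (fun t => (t - (s + ∑ i ∈ range n, x i)) ^ 2) s
        ≤ n * (G ^ 2 / 4) + (n * (1 / 2 * G)) ^ 2 :=
  accExpQ_sq_le_of_sameSide F (probAwayB_mem N) (fun η _ _ => probAwayB_sameSide N η)

/-- **StochasticC, every `N`, every window**: `E(ŝₙ − sₙ)² ≤ n·G²/4 + (n·G/2)²`. -/
theorem stochasticC_acc_sq_le_half (F : Finset K) (N : ℕ) {G : K} :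
    ∀ (x : ℕ → K) (n : ℕ) (s : K), NoSat F x n s → GapLE F G x n s →
      accExpQ F (probAwayC N) x n (fun t => (t - (s + ∑ i ∈ range n, x i)) ^ 2) s
        ≤ n * (G ^ 2 / 4) + (n * (1 / 2 * G)) ^ 2 :=
  accExpQ_sq_le_of_sameSide F (probAwayC_mem N) (fun η _ _ => probAwayC_sameSide N η)

/-- **IEEE P3109 StochasticA with ONE random bit obeys its Pythagorean law on every window**:
`E(ŝₙ − (s + ∑ xₖ))² ≤ n·G²/4 + (n·2^{-1}·G)²` whenever no branch saturates and every candidate gap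
met is `≤ G` — any finite format, any window (any number of binades, across zero), any sign pattern;
no drift-antitone hypothesis (XCIII needs `N ≥` binade span).  Near-tight:
`Formats.e3m2_oneBit_nearTight`. -/
theorem stochasticA_one_acc_sq_le (F : Finset K) {G : K} :
    ∀ (x : ℕ → K) (n : ℕ) (s : K), NoSat F x n s → GapLE F G x n s →
      accExpQ F (probAwayA 1) x n (fun t => (t - (s + ∑ i ∈ range n, x i)) ^ 2) s
        ≤ n * (G ^ 2 / 4) + (n * (1 / 2 ^ 1 * G)) ^ 2 := by
  intro x n s hns hg
  rw [pow_one]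
  exact stochasticA_acc_sq_le_half F le_rfl x n s hns hg

/-- ... and against ADAPTIVE summands, from any initial error `E`:
`E (E + ŝₙ − exact)² ≤ (|E| + n·G/2)² + n·G²/4`. -/
theorem stochasticA_one_accErr_sq_le (F : Finset K) {G : K} :
    ∀ (ξ : ℕ → K → K) (n : ℕ) (s E : K), NoSatA F ξ n s → GapLEA F G ξ n s →
      accErrQ F (probAwayA 1) ξ n (fun e => e ^ 2) s E ≤ (|E| + n * (1 / 2 * G)) ^ 2 + n * (G ^ 2 / 4) :=
  accErrQ_sq_le_of_sameSide F (probAwayA_mem 1) (fun η _ _ => probAwayA_sameSide le_rfl η)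

end P3109

/-! ### The whole range of every binary format, one random bit -/

section Formats

open Literature.ComputerArithmetic.FloatingPoint (Format MiniFloat)
open Literature.ComputerArithmetic.FloatingPoint.MiniFloat (valueSet valueSet_nonempty)

/-- An unsaturated tree of a format meets only candidate gaps `≤ 2^{emaxCode−1}·quantum`, the top
spacing (from XCV `valueSet_nestedWindow` and XCVII `gapLE_twoSided`). -/
theorem valueSet_gapLE_of_noSat (φ : Format) (x : ℕ → ℚ) (n : ℕ) (s : ℚ)
    (hns : NoSat (valueSet φ) x n s) : GapLE (valueSet φ) (2 ^ (φ.emaxCode - 1) * φ.quantum) x n s := by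
  have h0 := Summit.Ventures.CertifiedArithmetic.zero_mem_valueSet φ
  have hmem := MiniFloat.maxRat_mem_valueSet φ
  have hP := valueSet_nestedWindow φ h0 hmem le_rfl
  rw [binadeIdx_zero, pow_zero, one_mul, Nat.sub_zero] at hP
  have htop : binadeIdx φ φ.maxRat ≤ φ.emaxCode - 1 := Format.shift_le _
  have hG : (2 : ℚ) ^ binadeIdx φ φ.maxRat * φ.quantum ≤ 2 ^ (φ.emaxCode - 1) * φ.quantum :=
    mul_le_mul_of_nonneg_right (pow_le_pow_right₀ (by norm_num) htop) φ.quantum_pos.le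
  exact gapLE_twoSided (valueSet_symm φ) hP hP hG hG x n s hns (inWindow_of_noSat φ x n s hns)

/-- **THE WHOLE RANGE, every format, ONE random bit.**  Every StochasticA accumulation with one random
bit that never saturates — any signs, any data, any `n` — satisfies
`E(ŝₙ − sₙ)² ≤ n·G²/4 + (n·2^{-1}·G)²` with `G = 2^{emaxCode−1}·quantum` (the top spacing): the
conclusion of XCVIII `valueSet_stochasticA_all` at `N = 1` with NO bit threshold, although by CI
(`valueSet_stochasticA_driftAntitone_iff`) one bit is not drift-antitone on the whole range of any
format with `emaxCode ≥ 3`. -/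
theorem valueSet_stochasticA_one (φ : Format) (x : ℕ → ℚ) (n : ℕ) (s : ℚ)
    (hns : NoSat (valueSet φ) x n s) :
    accExpQ (valueSet φ) (probAwayA 1) x n (fun t => (t - (s + ∑ i ∈ range n, x i)) ^ 2) s
      ≤ n * ((2 ^ (φ.emaxCode - 1) * φ.quantum) ^ 2 / 4)
        + (n * (1 / 2 ^ 1 * (2 ^ (φ.emaxCode - 1) * φ.quantum))) ^ 2 :=
  stochasticA_one_acc_sq_le (valueSet φ) x n s hns (valueSet_gapLE_of_noSat φ x n s hns)

end Formats

end LimitedBits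

/-! ### Kernel-checked instances (E3M2, exact rational arithmetic) -/

namespace Formats

open LimitedBits

/-- **Near-tightness of the one-bit law**: E3M2, binade `[8, 16]` (`G = 2`), `ŝ₀ = 8`, three summands
`63/32` (`θ = 63/64` at every branch point): `E(ŝ₃ − 445/32)² = 11721/1024` against the law
`3·G²/4 + (3·G/2)² = 12` (ratio `0.954`); one and two additions give `1985/1024 ≤ 2`, `1473/256 ≤ 6`. -/
theorem e3m2_oneBit_nearTight :
    NoSat e3m2 (seqL [63 / 32, 63 / 32, 63 / 32]) 3 8 ∧ GapLE e3m2 2 (seqL [63 / 32, 63 / 32, 63 / 32]) 3 8 ∧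
      accExpQ e3m2 (probAwayA 1) (seqL [63 / 32, 63 / 32, 63 / 32]) 3 (fun t => (t - 445 / 32) ^ 2) 8
        = 11721 / 1024 ∧
      (3 : ℚ) * (2 ^ 2 / 4) + (3 * (1 / 2 ^ 1 * 2)) ^ 2 = 12 ∧ (11721 : ℚ) / 1024 < 12 ∧
      accExpQ e3m2 (probAwayA 1) (seqL [63 / 32]) 1 (fun t => (t - 319 / 32) ^ 2) 8 = 1985 / 1024 ∧
      accExpQ e3m2 (probAwayA 1) (seqL [63 / 32, 63 / 32]) 2 (fun t => (t - 382 / 32) ^ 2) 8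
        = 1473 / 256 := by
  refine ⟨?_, ?_, by decide +kernel, by norm_num, by norm_num, by decide +kernel, by decide +kernel⟩
  · rw [← noSatB_iff]; decide +kernel
  · rw [← gapLEB_iff]; decide +kernel

/-- **The XCIII scope example is now certified**: E3M2, `ŝ₀ = 3`, summands `−9/8, 5/2` (three binades,
NOT drift-antitone for one bit, `e3m2_threeBinade_A1_not`): the hypotheses of
`stochasticA_one_acc_sq_le` hold with `G = 1`, so `E(ŝ₂ − 35/8)² (= 13/64) ≤ 2·G²/4 + (2·G/2)² = 3/2`. -/
theorem e3m2_threeBinade_A1_certified :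
    accExpQ e3m2 (probAwayA 1) (seqL [-9 / 8, 5 / 2]) 2
        (fun t => (t - (3 + ∑ i ∈ range 2, seqL [-9 / 8, 5 / 2] i)) ^ 2) 3
      ≤ ((2 : ℕ) : ℚ) * ((1 : ℚ) ^ 2 / 4) + (((2 : ℕ) : ℚ) * (1 / 2 ^ 1 * (1 : ℚ))) ^ 2 :=
  stochasticA_one_acc_sq_le e3m2 (G := 1) _ 2 3 (by rw [← noSatB_iff]; decide +kernel)
    (by rw [← gapLEB_iff]; decide +kernel)

/-- **StochasticB with one bit, XCII's violator of the nominal law, obeys the `ε = 1/2` law**: from `6`,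
summands `5/2, 1/2, 1/2, −3/2` across the binade boundary `8` (`G = 2`): `E(ŝ₄ − 8)² = 129/16`;
nominal law `8 < 129/16` (XCII), sign-consistent law `4·G²/4 + (4·G/2)² = 20 ≥ 129/16`. -/
theorem e3m2_W2_stochasticB1_halfLaw :
    accExpQ e3m2 (probAwayB 1) xW2 4 (fun t => (t - (6 + ∑ i ∈ range 4, xW2 i)) ^ 2) 6
        ≤ ((4 : ℕ) : ℚ) * ((2 : ℚ) ^ 2 / 4) + (((4 : ℕ) : ℚ) * (1 / 2 * (2 : ℚ))) ^ 2 ∧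
      accExpQ e3m2 (probAwayB 1) xW2 4 (fun t => (t - 8) ^ 2) 6 = 129 / 16 ∧
      (4 : ℚ) * (2 ^ 2 / 4) + (4 * (1 / 2 * 2)) ^ 2 = 20 :=
  ⟨stochasticB_acc_sq_le_half e3m2 1 (G := 2) xW2 4 6 (by rw [← noSatB_iff]; decide +kernel)
    (by rw [← gapLEB_iff]; decide +kernel), by decide +kernel, by norm_num⟩

/-- The adaptive two-bit adversary: first summand `47/32`; second summand `1` if the first rounding went
up (to `10`), else `47/32` again. -/
def ξa : ℕ → ℚ → ℚ := fun k t => if k = 0 then 47 / 32 else if t = 10 then 1 else 47 / 32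

/-- **Two random bits: an ADAPTIVE adversary breaks the nominal law inside one binade.**  E3M2, all
values in `[8, 12] ⊂ [8, 16]` (gap `G = 2`), `ŝ₀ = 8`, strategy `ξa`: first pre-rounding value
`303/32` (`θ = 47/64`, StochasticA₂ rounds up with probability `1/2`); after UP the summand `1` puts
`θ = 1/2` (maximal variance, no bias), after DOWN the summand `47/32` repeats `θ = 47/64` (maximal
truncation).  No saturation, gaps `≤ 2`, and `E(ŝ₂ − exact)² = 6181/2048 > 3 = 2·G²/4 + (2·2^{-2}·G)²`:
the two-bit analogue of `stochasticA_one_accErr_sq_le` is FALSE.  Both frozen summand sequences obey the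
law (`2273/1024`, `737/256 ≤ 3`), and ONE bit obeys its own law `(2·G/2)² + 2·G²/4 = 6` on the same
adaptive data (value `6181/2048`, the trees coincide).  Consequently no bound through a function of
(accumulated error, steps to go) alone proves the two-bit law for fixed summands. -/
theorem e3m2_adaptive_twoBits_violates :
    NoSatA e3m2 ξa 2 8 ∧ GapLEA e3m2 2 ξa 2 8 ∧
      accErrQ e3m2 (probAwayA 2) ξa 2 (fun e => e ^ 2) 8 0 = 6181 / 2048 ∧
      (2 : ℚ) * (2 ^ 2 / 4) + (2 * (1 / 2 ^ 2 * 2)) ^ 2 = 3 ∧ (3 : ℚ) < 6181 / 2048 ∧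
      accExpQ e3m2 (probAwayA 2) (seqL [47 / 32, 1]) 2 (fun t => (t - 335 / 32) ^ 2) 8 = 2273 / 1024 ∧
      accExpQ e3m2 (probAwayA 2) (seqL [47 / 32, 47 / 32]) 2 (fun t => (t - 350 / 32) ^ 2) 8
        = 737 / 256 ∧
      accErrQ e3m2 (probAwayA 1) ξa 2 (fun e => e ^ 2) 8 0 = 6181 / 2048 ∧
      (6181 : ℚ) / 2048 ≤ (|0| + 2 * (1 / 2 * 2)) ^ 2 + 2 * (2 ^ 2 / 4) := by
  refine ⟨?_, ?_, by decide +kernel, by norm_num, by norm_num, by decide +kernel, by decide +kernel,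
    by decide +kernel, by norm_num⟩
  · rw [← noSatAB_iff]; decide +kernel
  · rw [← gapLEAB_iff]; decide +kernel

end Formats

end Summit.Ventures.CertifiedArithmetic.LowPrec.SR
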